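import Summits.AtomisticToContinuum.HydrodynamicLimit.Theorems.AntiMazurCoboundariesCorrectorPressureDecayKiferUniformGibbsGlueCore
import Summits.AtomisticToContinuum.HydrodynamicLimit.Theorems.AntiMazurCoboundariesCorrectorPressureDecayKiferCanonicalCellTuple
import Summits.AtomisticToContinuum.HydrodynamicLimit.Theorems.AntiMazurCoboundariesCorrectorPressureDecayKiferCollarTrick
import Summits.AtomisticToContinuum.HydrodynamicLimit.Theorems.AntiMazurCoboundariesCorrectorPressureDecayKiferKLConditioning
import Summits.AtomisticToContinuum.HydrodynamicLimit.Theorems.AntiMazurCoboundariesCorrectorPressureDecayKiferEntropyUniformShearer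
import Summits.AtomisticToContinuum.HydrodynamicLimit.Theorems.AntiMazurCoboundariesCorrectorPressureDecayKiferEntropyLsc
import Summits.AtomisticToContinuum.HydrodynamicLimit.Theorems.AntiMazurCoboundariesCorrectorPressureDecayKiferGibbsReferenceSwap
import Summits.AtomisticToContinuum.HydrodynamicLimit.Theorems.AntiMazurCoboundariesCorrectorPressureDecayKiferCanonicalLocalLimit
import Summits.AtomisticToContinuum.HydrodynamicLimit.Theorems.AntiMazurCoboundariesCorrectorPressureDecayTangentTightnessLaplace
import Mathlib.Probability.ConditionalProbability

/-!
# The finite-`N` cell inequality of the Gibbs route (line `FirstLemma`, crux stmt-AtomisticToContinuum-14135)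

Helper file of the registered stub `stub_tangentEntropyBoundUniformGibbs : TangentEntropyBoundUniformGibbs` (Gibbs route of
lead seat c9), namespace `Summit.AtomisticToContinuum.HydrodynamicLimit.Theorems.KiferCompactification`. It proves the
registered sub-goal `canonicalCellInequality_holds : CanonicalCellInequality` (statement in `…KiferUniformGibbsPieces.lean`):
cutting the blown-up torus cube `(-S/2, S/2]³`, `S = ε_N⁻¹`, into `m³` congruent cells `c9Cell S m j`, for every probability
law `Q` on `(N+1)`-particle torus phase space and every base point `x₀`
`Σ_j KL((Q ∘ blowUp_{x₀}⁻¹)_{cell j} ‖ γ_{cell j}) ≤ KL(Q ‖ G_N) + c_N(m)`, `γ_Λ = gibbsSpecMeasure 1 z θ⁻¹ u₀ Λ ∅` the free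
cell measure and `c_N(m) = canonicalBlockConst …` the `Q`-independent block constant.

**Proof.** Let `T ω := (windowRestrict (cell j) ω)_j` be the cell-tuple map, `P := T_* (Q ∘ blowUp_{x₀}⁻¹)` and
`G' := T_* (G_N ∘ blowUp_{x₀}⁻¹)`. The window laws of the cells are the marginals of `P`, so Shearer's superadditivity over
the independent blocks of the product reference (`sum_klDiv_map_eval_le_klDiv_pi`, …KiferEntropyUniformShearer) gives
`Σ_j KL(P_j ‖ γ_j) ≤ KL(P ‖ ⊗_j γ_j)`. By the identification `c9_map_cellTuple_canonicalBlowUp_eq_cond`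
(…KiferCanonicalCellTuple) `G' = (⊗_j γ_j)[|E]`, `E` the torus hard core with total number `N+1`, at EVERY base point — so
the block constant (defined at base point `0`) is `KL(G' ‖ ⊗γ)`. If `P ≪ G'`, the additivity of `KL` along the conditioning
(`c9_klDiv_eq_klDiv_cond_add_klDiv_cond`, …KiferKLConditioning) reads `KL(P ‖ ⊗γ) = KL(P ‖ G') + KL(G' ‖ ⊗γ)` and data
processing through `T ∘ blowUp_{x₀}` (`klDiv_map_le_klDiv`, …KiferEntropyLsc; measurability of the blow-up at a fixed base point is
`measurable_blowUp_left`, …KiferUniformGibbsGlueCore) bounds the first term by `KL(Q ‖ G_N)`;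
otherwise `Q` is not absolutely continuous with respect to `G_N` and the right side is `∞`.
-/

noncomputable section

open MeasureTheory ProbabilityTheory Set Filter Topology InformationTheory
open scoped ENNReal NNReal

namespace Summit.AtomisticToContinuum.HydrodynamicLimit.Theorems.KiferCompactification

open Literature.MathematicalPhysics.KineticTheory (T3 V3 hsDiameter hsDiameter_pos localGibbsLaw blowUpPoint blowUp
  isProbabilityMeasure_localGibbsLaw)
open Literature.MathematicalPhysics.KineticTheory.HardSphereDLR (gibbsSpecMeasure)
open Literature.MathematicalPhysics.KineticTheory.PointProcess (windowLaw windowRestrict centredBox measurable_windowRestrict)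
open Literature.Analysis.FluidPDE (HardSphereFlow Config IsHardCore IsHardSphereGibbs IsTranslationInvariant)
open Literature.Analysis.FunctionSpaces (PointConfig)

/-! ## Measurability of the cell-tuple map -/

/-- The cell-tuple map `ω ↦ (windowRestrict (cell j) ω)_j` is measurable. -/
theorem cellIneq_measurable_cellTuple (S : ℝ) (m : ℕ) :
    Measurable fun (ω : PointConfig (V3 × V3)) (j : Fin 3 → Fin m) => windowRestrict (c9Cell S m j) ω :=
  measurable_pi_lambda _ fun j => measurable_windowRestrict (measurableSet_c9Cell S m j)

/-! ## The cell inequality -/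

/-- **The finite-`N` cell inequality holds.** Shearer's superadditivity over the independent cells of the product reference, the
additivity of `KL` along the conditioning `G' = (⊗γ_j)[|E]` (the identification `c9_map_cellTuple_canonicalBlowUp_eq_cond`), and data
processing through the blow-up and the cell-tuple map. The block constant does not depend on the base point because the identification
holds at every base point with the same right-hand side. -/
theorem canonicalCellInequality_holds : CanonicalCellInequality := by
  intro σ a θ u₀ z hσ hσ2 ha hθ hz N Φ x₀ m hm Q hQ
  classical
  set GN := localGibbsLaw σ (fun _ => a) (fun _ => u₀) (fun _ => θ) N Φ with hGN
  set γ : (Fin 3 → Fin m) → Measure (PointConfig (V3 × V3)) := fun j => gibbsSpecMeasure 1 z θ⁻¹ u₀ (c9Cell (hsDiameter σ N)⁻¹ m j) ∅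
    with hγ
  set T : PointConfig (V3 × V3) → (Fin 3 → Fin m) → PointConfig (V3 × V3) := fun ω j => windowRestrict (c9Cell (hsDiameter σ N)⁻¹ m j) ω
    with hT
  set E := c9TorusHardCoreTuples (hsDiameter σ N)⁻¹ m (N + 1) with hE
  haveI hGNp : IsProbabilityMeasure GN :=
    isProbabilityMeasure_localGibbsLaw continuous_const continuous_const continuous_const (fun _ => ha) (fun _ => hθ) hσ2 N Φ
  haveI hγp : ∀ j, IsProbabilityMeasure (γ j) := fun j =>
    isProbabilityMeasure_gibbsSpecMeasure_empty hz.le (inv_pos.2 hθ) u₀ (measurableSet_c9Cell _ m j)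
      (isBounded_c9Cell _ m j).measure_lt_top.ne
  have hTm : Measurable T := cellIneq_measurable_cellTuple (hsDiameter σ N)⁻¹ m
  have hBm : Measurable fun zc : Config (N + 1) (Fin 3) T3 => blowUp (hsDiameter σ N) x₀ zc :=
    measurable_blowUp_left (hsDiameter σ N) x₀ (N + 1)
  -- the tuple laws
  set P : Measure ((Fin 3 → Fin m) → PointConfig (V3 × V3)) := (Q.map (blowUp (hsDiameter σ N) x₀)).map T with hP
  set G' : Measure ((Fin 3 → Fin m) → PointConfig (V3 × V3)) := (GN.map (blowUp (hsDiameter σ N) x₀)).map T with hG'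
  haveI hQb : IsProbabilityMeasure (Q.map (blowUp (hsDiameter σ N) x₀)) := Measure.isProbabilityMeasure_map hBm.aemeasurable
  haveI hGb : IsProbabilityMeasure (GN.map (blowUp (hsDiameter σ N) x₀)) := Measure.isProbabilityMeasure_map hBm.aemeasurable
  haveI hPp : IsProbabilityMeasure P := Measure.isProbabilityMeasure_map hTm.aemeasurable
  haveI hG'p : IsProbabilityMeasure G' := Measure.isProbabilityMeasure_map hTm.aemeasurable
  -- the identification at the base point `x₀` and at `0`
  have hid : G' = (Measure.pi γ)[|E] := c9_map_cellTuple_canonicalBlowUp_eq_cond σ a θ u₀ hσ hσ2 ha hθ hz N Φ x₀ hm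
  have hid0 : (GN.map (blowUp (hsDiameter σ N) 0)).map T = (Measure.pi γ)[|E] :=
    c9_map_cellTuple_canonicalBlowUp_eq_cond σ a θ u₀ hσ hσ2 ha hθ hz N Φ 0 hm
  have hconst : canonicalBlockConst σ a θ u₀ z N Φ m = klDiv G' (Measure.pi γ) := by
    rw [canonicalBlockConst, hid]
    exact congrArg (fun μ => klDiv μ (Measure.pi γ)) hid0
  -- the window laws of the cells are the marginals of `P`
  have hmarg : ∀ j, windowLaw (c9Cell (hsDiameter σ N)⁻¹ m j) (Q.map (blowUp (hsDiameter σ N) x₀)) = P.map (Function.eval j) := by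
    intro j
    rw [hP, Measure.map_map (measurable_pi_apply j) hTm]
    rfl
  -- Shearer over the product reference
  have hshearer : ∑ j, klDiv (windowLaw (c9Cell (hsDiameter σ N)⁻¹ m j) (Q.map (blowUp (hsDiameter σ N) x₀))) (γ j) ≤ klDiv P (Measure.pi γ) := by
    calc ∑ j, klDiv (windowLaw (c9Cell (hsDiameter σ N)⁻¹ m j) (Q.map (blowUp (hsDiameter σ N) x₀))) (γ j)
        = ∑ j, klDiv (P.map (Function.eval j)) (γ j) := Finset.sum_congr rfl fun j _ => by rw [hmarg j]
      _ ≤ klDiv P (Measure.pi γ) := sum_klDiv_map_eval_le_klDiv_pi P γ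
  refine hshearer.trans ?_
  -- additivity along the conditioning, or triviality when `Q` is not absolutely continuous
  by_cases hac : P ≪ G'
  · have hPE : P ≪ (Measure.pi γ)[|E] := hid ▸ hac
    haveI : IsProbabilityMeasure (Measure.pi γ) := inferInstance
    have hEm : MeasurableSet E := measurableSet_c9TorusHardCoreTuples _ m (N + 1)
    rw [c9_klDiv_eq_klDiv_cond_add_klDiv_cond P (Measure.pi γ) hEm hPE, ← hid, hconst]
    gcongr
    -- data processing through `T ∘ blowUp (hsDiameter σ N) x₀`
    calc klDiv P G' ≤ klDiv (Q.map (blowUp (hsDiameter σ N) x₀)) (GN.map (blowUp (hsDiameter σ N) x₀)) :=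
            klDiv_map_le_klDiv _ _ hTm
      _ ≤ klDiv Q GN := klDiv_map_le_klDiv _ _ hBm
  · -- `Q` is not absolutely continuous with respect to `G_N`
    have hQ : ¬ Q ≪ GN := fun h => hac ((h.map hBm).map hTm)
    rw [klDiv_of_not_ac hQ]
    exact le_top.trans_eq (top_add _).symm

end Summit.AtomisticToContinuum.HydrodynamicLimit.Theorems.KiferCompactification

end
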